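import Literature.AlgebraicGeometry.HodgeTheory.ZariskiOpenBettiFiniteness
import Literature.AlgebraicGeometry.HodgeTheory.ComplexPointsSemialgebraicModel
import Literature.AlgebraicGeometry.HodgeTheory.HodgeSectionRestrictionTriangulable
import Literature.AlgebraicGeometry.Motives.ComplexPointsManifold
import Literature.AlgebraicGeometry.Motives.VarietiesProperProofs
import Literature.ModelTheory.ExponentialFields.SemialgebraicTriangulationTheorem
import Literature.AlgebraicTopology.SingularHomology.MayerVietorisFiniteness
import Literature.AlgebraicTopology.SingularHomology.CellsAttachmentEuler
import Literature.AlgebraicTopology.SingularHomology.CohomologyFiniteness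
import HarnessLib

/-!
# The integral homology of a Zariski open of a smooth projective complex variety is finitely
# generated (Dimca 1992, Ch. 1 Cor. (6.10)) — proved

Topic `Literature/AlgebraicGeometry/HodgeTheory`. This file DISCHARGES the named fact
`Dimca1992_finite_singularHomology_complexPointsCompl` (`HodgeTheory/ZariskiOpenBettiFiniteness`):
for `X` smooth projective over `ℂ`, `Z ⊆ X` Zariski-closed and every `k`, the integral singular
homology `Hₖ((X ∖ Z)(ℂ); ℤ)` of the complex points of the open subscheme `X ∖ Z` (the tree's
`Motives.complexPointsCompl X Z`, strong topology) is finitely generated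
(`Dimca1992_finite_singularHomology_complexPointsCompl_holds`). A. Dimca, *Singularities and Topology
of Hypersurfaces* (1992), Ch. 1 Cor. (6.10): "Any algebraic variety has the homotopy type of a finite
CW-complex … the homology and cohomology groups … are all finitely generated". The degree-one case
was proved without triangulations in `ZariskiOpenHOneFiniteness`; here all degrees follow from the
tree's PROVED semialgebraic triangulation theorem.

## The proof

* **Model and triangulation of the pair** (`exists_homeomorph_space_diff_space`). For `X` separated
  of finite type over `ℂ` with `X(ℂ)` compact, `SemialgModel.exists_semialgebraic_model`
  (`ComplexPointsSemialgebraicModel`, with `K = X(ℂ)`) gives a continuous injection `Ψ : X(ℂ) → ℝᴺ`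
  with `S = Ψ(X(ℂ))` and `A = Ψ(Z(ℂ))` semialgebraic; `S` is compact, so `Ψ` is a closed embedding.
  The tree's semialgebraic triangulation theorem `semialgebraic_triangulation`
  (`ModelTheory/ExponentialFields/SemialgebraicTriangulationTheorem`, Łojasiewicz 1964 /
  Ohmoto–Shiota 2017 Thm. 2.2, proved there) triangulates `S` by a FINITE geometric simplicial
  complex `K` compatibly with `A`, and `exists_subcomplex_preimage` extracts the subcomplex `L` over
  the closed set `A`; whence `(X ∖ Z)(ℂ) ≃ₜ |K| ∖ |L|`.
* **Open stars.** For a vertex set `ρ`, `St ρ = {y ∈ |K| : every simplex through y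
  contains ρ}`; `St ρ ∩ St ρ' = St (ρ ∪ ρ')` (`faceStar_inter`, `biInter_faceStar`); by the carrier
  lemma (`subset_of_mem_openSimplex_of_mem_convexHull`: a point of the open simplex of `σ` lying in
  `conv t` forces `σ ⊆ t`, uniqueness of barycentric coordinates) `St ρ` is the trace on `|K|` of
  the open star `U_b` of any interior point `b` of `ρ` (`Polyhedron.starNhd`,
  `faceStar_eq_space_inter_starNhd`), hence open in `|K|` and star-shaped
  (`Polyhedron.starConvex_space_inter_starNhd`), so empty or contractible, with finitely generated
  homology (`finite_singularHomology_faceStar`; Hatcher Prop. 2.7, App. Prop. A.4).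
* **Cover** (`space_diff_space_eq_biUnion_faceStar`): `|K| ∖ |L| = ⋃ {St σ : σ ∈ K ∖ L}` — a point
  off `|L|` lies in the open simplex of a face `τ ∉ L`, hence in `St τ`; a point of `St σ` in `|L|`
  would lie in a simplex of a face `t ∈ L` with `σ ⊆ t`, forcing `σ ∈ L` (down-closure).
* **Mayer–Vietoris induction** (`finite_singularHomology_biUnion`): a finite union of open sets all
  of whose non-empty finite sub-intersections have finitely generated homology in every degree has
  finitely generated homology in every degree (`openUnion.finite_singularHomology`, Hatcher §2.2
  p. 149, one set at a time). Hence `|K| ∖ |L|` (`finite_singularHomology_space_diff_space`), and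
  `(X ∖ Z)(ℂ)` (`finite_singularHomology_complexPointsCompl`, any Noetherian coefficients), have
  finitely generated homology. (Classically: `|K| ∖ |L|` deformation retracts onto a finite
  subcomplex of the first barycentric subdivision, Munkres 1984 Lemma 70.1; the open-star cover
  avoids subdivisions.)

* **Cohomology** (`finite_singularCohomology_complexPointsCompl`,
  `Dimca1992_finite_singularCohomology_complexPointsCompl`): by universal coefficients over a
  principal ideal domain (`finite_singularCohomology_of_finite_singularHomology`, Hatcher Cor. 3.3)
  the cohomology `Hᵏ((X ∖ Z)(ℂ); N)` is finitely generated too — the cohomological half of Dimca's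
  Cor. (6.10).

Everything here is proved; no definition of the tree is modified and no named fact is introduced
(the open star `St ρ = {y ∈ |K| | ∀ t ∈ K, y ∈ conv t → ρ ⊆ t}` is written out as a set-builder set, not
defined). Consumer: the route `GenericDivisibility` of the summit
`HodgeConjecture` (`Summits/HodgeConjecture/HodgeConjecture/Theorems/GenericDivisibilityHodgeClassesGenericallyDivisibleFinite`:
the hypothesis `hfin` of `hodgeClassesGenericallyDivisible_of_hodgeConjecture_of_finite`, universal
coefficients on `(X ∖ Z)(ℂ)`), where it removes the Dimca hypothesis from "HC ⟹ C1".

## References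

* [Dimca1992] A. Dimca, Singularities and Topology of Hypersurfaces, Universitext, Springer 1992,
  Ch. 1 Thm. (6.9), Cor. (6.10).
* [BochnakCosteRoy1998] J. Bochnak, M. Coste, M.-F. Roy, Real Algebraic Geometry, Springer 1998,
  §2.2, Thm. 9.2.1 (semialgebraic triangulation).
* [OhmotoShiota2017] T. Ohmoto, M. Shiota, C¹-triangulations of semialgebraic sets, J. Topology 10
  (2017), Thm. 2.2.
* [HatcherAT2002] A. Hatcher, Algebraic Topology, CUP 2002, §2.1, Prop. 2.7, §2.2 p. 149,
  App. Prop. A.4.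
* [Munkres1984] J. R. Munkres, Elements of Algebraic Topology, Addison–Wesley 1984, §70 Lemma 70.1.
-/

noncomputable section

open CategoryTheory Limits Set TopologicalSpace AlgebraicGeometry Topology
open Literature.AlgebraicTopology.SingularHomology
open Literature.ModelTheory.ExponentialFields
open Literature.AlgebraicGeometry.Motives

universe u

namespace Literature.AlgebraicGeometry.HodgeTheory

namespace ZariskiOpenFiniteness


/-! ### Mayer–Vietoris induction: finite unions of opens with acyclic-enough intersections -/

section MV

variable (R : Type) [CommRing R] (M : Type) [AddCommGroup M] [Module R M]
variable {Y : Type u} [TopologicalSpace Y]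

/-- The empty subspace has finitely generated (indeed zero) homology. [folklore] -/
theorem finite_singularHomology_of_isEmpty (A : Set Y) (hA : A = ∅) (k : ℕ) :
    Module.Finite R (singularHomology R M ↥A k) := by
  haveI : IsEmpty ↥A := by subst hA; exact Set.isEmpty_coe_sort.mpr rfl
  haveI : IsEmpty ↥(Set.univ : Set ↥A) := ⟨fun P ↦ IsEmpty.false P.1⟩
  haveI := relativeSingularHomology.isIso_ofAbsolute_of_isEmpty R M (X := ↥A) Set.univ k
  have h0 : IsZero (singularHomology R M ↥A k) :=
    (isZero_relativeSingularHomology_univ R M (X := ↥A) k).of_iso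
      (asIso (relativeSingularHomology.ofAbsolute R M ↥A Set.univ k))
  exact finite_of_isZero h0

variable [IsNoetherianRing R]

/-- **Finite type from a finite cover.** If a finite family of open subsets of `Y` has all its
non-empty finite sub-intersections with finitely generated homology in every degree, the union has
finitely generated homology in every degree (induction on the number of sets with the Mayer–Vietoris
step `openUnion.finite_singularHomology`; Hatcher 2002, §2.2 p. 149). [cite: HatcherAT2002, §2.2 p. 149] -/
theorem finite_singularHomology_biUnion {ι : Type*} [DecidableEq ι] (s : Finset ι) :
    ∀ (U : ι → Set Y), (∀ i ∈ s, IsOpen (U i)) →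
      (∀ s' : Finset ι, s' ⊆ s → s'.Nonempty →
        ∀ k, Module.Finite R (singularHomology R M ↥(⋂ i ∈ s', U i) k)) →
      ∀ k, Module.Finite R (singularHomology R M ↥(⋃ i ∈ s, U i) k) := by
  induction s using Finset.induction_on with
  | empty =>
    intro U _ _ k
    exact finite_singularHomology_of_isEmpty R M _ (by simp) k
  | insert a s ha ih =>
    intro U hU hfin k
    have hUa : IsOpen (U a) := hU a (Finset.mem_insert_self a s)
    have hUs : ∀ i ∈ s, IsOpen (U i) := fun i hi ↦ hU i (Finset.mem_insert_of_mem hi)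
    have hB : IsOpen (⋃ i ∈ s, U i) := isOpen_biUnion fun i hi ↦ hUs i hi
    -- the union over `s`
    have hfinB : ∀ k, Module.Finite R (singularHomology R M ↥(⋃ i ∈ s, U i) k) :=
      ih U hUs fun s' hs' hne k ↦ hfin s' (hs'.trans (Finset.subset_insert a s)) hne k
    -- the intersection `U a ∩ ⋃ U i = ⋃ (U a ∩ U i)`
    have hfinAB : ∀ k, Module.Finite R (singularHomology R M ↥(U a ∩ ⋃ i ∈ s, U i) k) := by
      intro k
      have h := ih (fun i ↦ U a ∩ U i) (fun i hi ↦ hUa.inter (hUs i hi)) ?_ k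
      · have heq : (⋃ i ∈ s, U a ∩ U i) = U a ∩ ⋃ i ∈ s, U i := (Set.inter_iUnion₂ _ _).symm
        haveI := h
        exact finite_singularHomology_of_homeomorph (Homeomorph.setCongr heq) k
      · intro s' hs' hne k
        have heq : (⋂ i ∈ insert a s', U i) = ⋂ i ∈ s', U a ∩ U i := by
          ext y
          simp only [Finset.mem_insert, mem_iInter, mem_inter_iff, forall_eq_or_imp]
          constructor
          · rintro ⟨hya, h⟩ i hi; exact ⟨hya, h i hi⟩
          · intro h
            obtain ⟨i₀, hi₀⟩ := hne
            exact ⟨(h i₀ hi₀).1, fun i hi ↦ (h i hi).2⟩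
        haveI := hfin (insert a s') (Finset.insert_subset_insert a hs') (Finset.insert_nonempty a s') k
        exact finite_singularHomology_of_homeomorph (Homeomorph.setCongr heq) k
    have hfinA : ∀ k, Module.Finite R (singularHomology R M ↥(U a) k) := by
      intro k
      have heq : (⋂ i ∈ ({a} : Finset ι), U i) = U a := by
        ext y; simp
      haveI := hfin {a} (Finset.singleton_subset_iff.mpr (Finset.mem_insert_self a s))
        (Finset.singleton_nonempty a) k
      exact finite_singularHomology_of_homeomorph (Homeomorph.setCongr heq) k
    have heq : (⋃ i ∈ insert a s, U i) = U a ∪ ⋃ i ∈ s, U i := Finset.set_biUnion_insert a s U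
    haveI := openUnion.finite_singularHomology R M hUa hB k (hfinA k) (hfinB k)
      (fun m _ ↦ hfinAB m)
    exact finite_singularHomology_of_homeomorph (Homeomorph.setCongr heq.symm) k

end MV

/-! ### Open stars of faces in a finite geometric simplicial complex -/

section Stars

variable {E : Type*} [NormedAddCommGroup E] [NormedSpace ℝ E]


/-- `{y | y ∈ K.space ∧ ∀ t ∈ K.faces, y ∈ convexHull ℝ (↑t : Set E) → ρ ⊆ t} ⊆ |K|`. [folklore] -/
theorem faceStar_subset_space (K : Geometry.SimplicialComplex ℝ E) (ρ : Finset E) :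
    {y | y ∈ K.space ∧ ∀ t ∈ K.faces, y ∈ convexHull ℝ (↑t : Set E) → ρ ⊆ t} ⊆ K.space := fun _ hy ↦ hy.1

/-- Open stars of faces are closed under intersection: `St ρ ∩ St ρ' = St (ρ ∪ ρ')`. [folklore] -/
theorem faceStar_inter [DecidableEq E] (K : Geometry.SimplicialComplex ℝ E) (ρ ρ' : Finset E) :
    {y | y ∈ K.space ∧ ∀ t ∈ K.faces, y ∈ convexHull ℝ (↑t : Set E) → ρ ⊆ t} ∩ {y | y ∈ K.space ∧ ∀ t ∈ K.faces, y ∈ convexHull ℝ (↑t : Set E) → ρ' ⊆ t} = {y | y ∈ K.space ∧ ∀ t ∈ K.faces, y ∈ convexHull ℝ (↑t : Set E) → (ρ ∪ ρ') ⊆ t} := by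
  ext y
  simp only [mem_inter_iff, mem_setOf_eq, Finset.union_subset_iff]
  constructor
  · rintro ⟨⟨hy, h⟩, -, h'⟩; exact ⟨hy, fun t ht hyt ↦ ⟨h t ht hyt, h' t ht hyt⟩⟩
  · rintro ⟨hy, h⟩; exact ⟨⟨hy, fun t ht hyt ↦ (h t ht hyt).1⟩, hy, fun t ht hyt ↦ (h t ht hyt).2⟩

/-- The intersection of the open stars of a non-empty finite family of vertex sets is the open
star of their union. [folklore] -/
theorem biInter_faceStar [DecidableEq E] (K : Geometry.SimplicialComplex ℝ E)
    {s : Finset (Finset E)} (hs : s.Nonempty) :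
    (⋂ ρ ∈ s, {y | y ∈ K.space ∧ ∀ t ∈ K.faces, y ∈ convexHull ℝ (↑t : Set E) → ρ ⊆ t}) = {y | y ∈ K.space ∧ ∀ t ∈ K.faces, y ∈ convexHull ℝ (↑t : Set E) → (s.sup id) ⊆ t} := by
  ext y
  simp only [mem_iInter, mem_setOf_eq, Finset.sup_le_iff, id_eq]
  constructor
  · intro h
    obtain ⟨ρ₀, hρ₀⟩ := hs
    exact ⟨(h ρ₀ hρ₀).1, fun t ht hyt ρ hρ ↦ (h ρ hρ).2 t ht hyt⟩
  · rintro ⟨hy, h⟩ ρ hρ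
    exact ⟨hy, fun t ht hyt ↦ h t ht hyt ρ hρ⟩

/-- **Carrier lemma.** If a point of the open simplex of a face `σ` lies in the simplex of a face
`t`, then `σ` is a face of `t`: the point lies in `conv σ ∩ conv t = conv (σ ∩ t)` and all its
barycentric coordinates on `σ` are positive, so `σ ⊆ t` by uniqueness of barycentric coordinates.
[cite: HatcherAT2002, §2.1 p. 103] -/
theorem subset_of_mem_openSimplex_of_mem_convexHull [DecidableEq E]
    {K : Geometry.SimplicialComplex ℝ E} {σ t : Finset E} (hσ : σ ∈ K.faces) (ht : t ∈ K.faces)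
    {x : E} (hx : x ∈ openSimplex ℝ σ) (hxt : x ∈ convexHull ℝ (t : Set E)) : σ ⊆ t := by
  obtain ⟨w, hw0, hw1, hwx⟩ := hx
  have hxσ : x ∈ convexHull ℝ (σ : Set E) := openSimplex_subset_convexHull (𝕜 := ℝ) σ ⟨w, hw0, hw1, hwx⟩
  have hxst : x ∈ convexHull ℝ ((σ ∩ t : Finset E) : Set E) := by
    rw [Finset.coe_inter, ← Geometry.SimplicialComplex.convexHull_inter_convexHull hσ ht]
    exact ⟨hxσ, hxt⟩
  obtain ⟨w', hw'0, hw'1, hw'x⟩ := Finset.mem_convexHull'.mp hxst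
  -- extend `w'` by zero to `σ`
  set W : E → ℝ := fun v ↦ if v ∈ σ ∩ t then w' v else 0 with hW
  have hsum : ∑ v ∈ σ, w v = ∑ v ∈ σ, W v := by
    rw [hw1]
    simp only [hW, Finset.sum_ite_mem, Finset.inter_eq_right.mpr Finset.inter_subset_left, hw'1]
  have hsumv : ∑ v ∈ σ, w v • v = ∑ v ∈ σ, W v • v := by
    rw [hwx]
    simp only [hW, ite_smul, zero_smul, Finset.sum_ite_mem,
      Finset.inter_eq_right.mpr Finset.inter_subset_left, hw'x]
  have heq := (K.indep hσ).eq_of_sum_eq_sum_subtype hsum hsumv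
  intro v hv
  by_contra hvt
  have h := heq v hv
  have hvst : v ∉ σ ∩ t := fun h' ↦ hvt (Finset.mem_inter.mp h').2
  simp only [hW, hvst, if_false] at h
  exact (hw0 v hv).ne' h

/-- For a face `ρ` and a point `b` of its open simplex, a face `t` contains `ρ` iff its simplex
contains `b`. [folklore] -/
theorem subset_iff_mem_convexHull [DecidableEq E] {K : Geometry.SimplicialComplex ℝ E}
    {ρ t : Finset E} (hρ : ρ ∈ K.faces) (ht : t ∈ K.faces) {b : E} (hb : b ∈ openSimplex ℝ ρ) :
    ρ ⊆ t ↔ b ∈ convexHull ℝ (t : Set E) :=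
  ⟨fun h ↦ convexHull_mono (Finset.coe_subset.mpr h) (openSimplex_subset_convexHull (𝕜 := ℝ) ρ hb),
    fun h ↦ subset_of_mem_openSimplex_of_mem_convexHull hρ ht hb h⟩

/-- The open star of a face `ρ` is the trace on `|K|` of the open star `U_b` of any point `b` of
its open simplex (`Polyhedron.starNhd`). [cite: HatcherAT2002, App. Prop. A.4] -/
theorem faceStar_eq_space_inter_starNhd [DecidableEq E] {K : Geometry.SimplicialComplex ℝ E}
    {ρ : Finset E} (hρ : ρ ∈ K.faces) {b : E} (hb : b ∈ openSimplex ℝ ρ) :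
    {y | y ∈ K.space ∧ ∀ t ∈ K.faces, y ∈ convexHull ℝ (↑t : Set E) → ρ ⊆ t} = K.space ∩ Polyhedron.starNhd K b := by
  ext y
  simp only [Polyhedron.starNhd, mem_inter_iff, mem_setOf_eq]
  constructor
  · rintro ⟨hy, h⟩; exact ⟨hy, fun t ht hyt ↦ (subset_iff_mem_convexHull hρ ht hb).mp (h t ht hyt)⟩
  · rintro ⟨hy, h⟩; exact ⟨hy, fun t ht hyt ↦ (subset_iff_mem_convexHull hρ ht hb).mpr (h t ht hyt)⟩

/-- A non-empty vertex set with non-empty open star is a face. [folklore] -/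
theorem mem_faces_of_faceStar_nonempty {K : Geometry.SimplicialComplex ℝ E} {ρ : Finset E}
    (hρ : ρ.Nonempty) (hne : ({y | y ∈ K.space ∧ ∀ t ∈ K.faces, y ∈ convexHull ℝ (↑t : Set E) → ρ ⊆ t}).Nonempty) : ρ ∈ K.faces := by
  obtain ⟨y, hy, h⟩ := hne
  obtain ⟨t, ht, hyt⟩ := Geometry.SimplicialComplex.mem_space_iff.mp hy
  exact K.down_closed ht (h t ht hyt) hρ

/-- A non-empty open star of a non-empty vertex set is star-shaped (about the barycentre of the
face), hence contractible. [cite: HatcherAT2002, App. Prop. A.4] -/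
theorem contractibleSpace_faceStar [DecidableEq E] {K : Geometry.SimplicialComplex ℝ E}
    {ρ : Finset E} (hρ : ρ.Nonempty) (hne : ({y | y ∈ K.space ∧ ∀ t ∈ K.faces, y ∈ convexHull ℝ (↑t : Set E) → ρ ⊆ t}).Nonempty) :
    ContractibleSpace ↥({y | y ∈ K.space ∧ ∀ t ∈ K.faces, y ∈ convexHull ℝ (↑t : Set E) → ρ ⊆ t}) := by
  have hρK := mem_faces_of_faceStar_nonempty hρ hne
  obtain ⟨b, hb⟩ := openSimplex_nonempty (𝕜 := ℝ) hρ
  rw [faceStar_eq_space_inter_starNhd hρK hb] at hne ⊢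
  exact (Polyhedron.starConvex_space_inter_starNhd K b).contractibleSpace hne

/-- Open stars have finitely generated homology in every degree (empty, or contractible).
[cite: HatcherAT2002, Prop. 2.7 and App. Prop. A.4] -/
theorem finite_singularHomology_faceStar [DecidableEq E] (R : Type) [CommRing R] (M : Type)
    [AddCommGroup M] [Module R M] [Module.Finite R M] {K : Geometry.SimplicialComplex ℝ E}
    {ρ : Finset E} (hρ : ρ.Nonempty) (k : ℕ) :
    Module.Finite R (singularHomology R M ↥({y | y ∈ K.space ∧ ∀ t ∈ K.faces, y ∈ convexHull ℝ (↑t : Set E) → ρ ⊆ t}) k) := by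
  rcases ({y | y ∈ K.space ∧ ∀ t ∈ K.faces, y ∈ convexHull ℝ (↑t : Set E) → ρ ⊆ t}).eq_empty_or_nonempty with h | hne
  · exact finite_singularHomology_of_isEmpty R M _ h k
  · haveI := contractibleSpace_faceStar hρ hne
    cases k with
    | zero => exact finite_singularHomology_zero_of_module_finite R M
    | succ k => exact finite_of_isZero (isZero_singularHomology_of_contractibleSpace R M k.succ_ne_zero)

/-- The open star of a face is open in `|K|` for a finite complex (its complement in `|K|` is a
finite union of closed simplices). [folklore] -/
theorem isOpen_preimage_faceStar {K : Geometry.SimplicialComplex ℝ E} (hK : K.faces.Finite)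
    (ρ : Finset E) : IsOpen (Subtype.val ⁻¹' {y | y ∈ K.space ∧ ∀ t ∈ K.faces, y ∈ convexHull ℝ (↑t : Set E) → ρ ⊆ t} : Set K.space) := by
  have hcl : IsClosed (⋃ t ∈ {t ∈ K.faces | ¬ ρ ⊆ t}, convexHull ℝ (t : Set E)) :=
    Set.Finite.isClosed_biUnion (hK.subset fun t ht ↦ ht.1) fun t _ ↦
      Set.Finite.isClosed_convexHull ℝ (s := (t : Set E)) t.finite_toSet
  have heq : (Subtype.val ⁻¹' {y | y ∈ K.space ∧ ∀ t ∈ K.faces, y ∈ convexHull ℝ (↑t : Set E) → ρ ⊆ t} : Set K.space) =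
      (Subtype.val ⁻¹' (⋃ t ∈ {t ∈ K.faces | ¬ ρ ⊆ t}, convexHull ℝ (t : Set E)))ᶜ := by
    ext y
    simp only [mem_preimage, mem_setOf_eq, mem_compl_iff, mem_iUnion, exists_prop,
      not_exists, not_and]
    exact ⟨fun h t ht hyt ↦ absurd (h.2 t ht.1 hyt) ht.2,
      fun h ↦ ⟨y.2, fun t ht hyt ↦ by_contra fun hn ↦ h t ⟨ht, hn⟩ hyt⟩⟩
  rw [heq]
  exact (hcl.preimage continuous_subtype_val).isOpen_compl

end Stars

/-! ### The complement of a subcomplex has finitely generated homology -/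

section Complement

variable {E : Type*} [NormedAddCommGroup E] [NormedSpace ℝ E]

/-- **Cover of `|K| ∖ |L|` by the open stars of the faces of `K` not in `L`** (`L` a subcomplex
of `K`): a point of `|K| ∖ |L|` lies in the open simplex of a face `τ ∉ L` and then in `St τ`;
conversely a point of `St σ`, `σ ∈ K ∖ L`, in `|L|` would lie in a simplex of a face `t ∈ L`
with `σ ⊆ t`, forcing `σ ∈ L`. [cite: HatcherAT2002, §2.1] -/
theorem space_diff_space_eq_biUnion_faceStar [DecidableEq E]
    {K L : Geometry.SimplicialComplex ℝ E} (hK : K.faces.Finite) (hLK : L.faces ⊆ K.faces) :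
    K.space \ L.space = ⋃ σ ∈ (hK.sdiff : (K.faces \ L.faces).Finite).toFinset, {y | y ∈ K.space ∧ ∀ t ∈ K.faces, y ∈ convexHull ℝ (↑t : Set E) → σ ⊆ t} := by
  ext y
  simp only [mem_sdiff, mem_iUnion, Set.Finite.mem_toFinset, exists_prop]
  constructor
  · rintro ⟨hyK, hyL⟩
    obtain ⟨τ, hτ, hyτ⟩ := exists_mem_openSimplex_of_mem_space hyK
    refine ⟨τ, ⟨hτ, fun hτL ↦ hyL ?_⟩, hyK, fun t ht hyt ↦
      subset_of_mem_openSimplex_of_mem_convexHull hτ ht hyτ hyt⟩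
    exact L.convexHull_subset_space hτL (openSimplex_subset_convexHull (𝕜 := ℝ) τ hyτ)
  · rintro ⟨σ, ⟨hσ, hσL⟩, hyK, h⟩
    refine ⟨hyK, fun hyL ↦ hσL ?_⟩
    obtain ⟨t, ht, hyt⟩ := Geometry.SimplicialComplex.mem_space_iff.mp hyL
    exact L.down_closed ht (h t (hLK ht) hyt) (K.nonempty_of_mem_faces hσ)

/-- **The complement of a subcomplex in a finite polyhedron has finitely generated homology** in
every degree: it is the finite union of the open stars of the faces of `K` not in `L`, a family of
open sets closed under intersection whose members are empty or contractible, so the Mayer–Vietoris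
induction `finite_singularHomology_biUnion` applies. (Classically: `|K| ∖ |L|` deformation retracts
onto a finite subcomplex of the barycentric subdivision; Munkres 1984, Lemma 70.1.)
[cite: HatcherAT2002, §2.2 p. 149 and App. Prop. A.4] -/
theorem finite_singularHomology_space_diff_space [DecidableEq E] (R : Type) [CommRing R]
    [IsNoetherianRing R] (M : Type) [AddCommGroup M] [Module R M] [Module.Finite R M]
    {K L : Geometry.SimplicialComplex ℝ E} (hK : K.faces.Finite) (hLK : L.faces ⊆ K.faces) (k : ℕ) :
    Module.Finite R (singularHomology R M ↥(K.space \ L.space) k) := by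
  -- the faces of `K` not in `L`, and the cover by their open stars pulled back to `|K|`
  have hsK : ∀ σ ∈ (hK.sdiff : (K.faces \ L.faces).Finite).toFinset, σ ∈ K.faces := fun σ hσ ↦
    ((Set.Finite.mem_toFinset _).mp hσ).1
  have hstep : ∀ s' ⊆ (hK.sdiff : (K.faces \ L.faces).Finite).toFinset, s'.Nonempty →
      ∀ k, Module.Finite R (singularHomology R M
        ↥(⋂ σ ∈ s', (Subtype.val ⁻¹' {y | y ∈ K.space ∧ ∀ t ∈ K.faces, y ∈ convexHull ℝ (↑t : Set E) → σ ⊆ t} : Set K.space)) k) := by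
    intro s' hs' hne k
    -- a non-empty sub-intersection is the open star of the union of the faces
    have hne' : (s'.sup id).Nonempty := by
      obtain ⟨σ, hσ⟩ := hne
      exact (K.nonempty_of_mem_faces (hsK σ (hs' hσ))).mono (Finset.le_sup (f := id) hσ)
    have heq : (Subtype.val ⁻¹' {y | y ∈ K.space ∧ ∀ t ∈ K.faces, y ∈ convexHull ℝ (↑t : Set E) → (s'.sup id) ⊆ t} : Set K.space) =
        ⋂ σ ∈ s', (Subtype.val ⁻¹' {y | y ∈ K.space ∧ ∀ t ∈ K.faces, y ∈ convexHull ℝ (↑t : Set E) → σ ⊆ t} : Set K.space) := by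
      rw [← biInter_faceStar K hne, Set.preimage_iInter₂]
    have h1 : Module.Finite R (singularHomology R M ↥({y | y ∈ K.space ∧ ∀ t ∈ K.faces, y ∈ convexHull ℝ (↑t : Set E) → (s'.sup id) ⊆ t}) k) :=
      finite_singularHomology_faceStar R M (K := K) hne' k
    have h2 : Module.Finite R (singularHomology R M
        ↥(Subtype.val ⁻¹' {y | y ∈ K.space ∧ ∀ t ∈ K.faces, y ∈ convexHull ℝ (↑t : Set E) → (s'.sup id) ⊆ t} : Set K.space) k) :=
      finite_singularHomology_of_homeomorph
        (SphereComplement.preimageValHomeomorphOfSubset (faceStar_subset_space K _)).symm k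
    exact finite_singularHomology_of_homeomorph (Homeomorph.setCongr heq) k
  -- the union (the sub-intersection hypothesis is passed through `by exact`: elaborating it
  -- against the bounded-intersection pattern before `U` is instantiated is prohibitively slow)
  have hU := finite_singularHomology_biUnion R M (Y := ↥K.space)
    (hK.sdiff : (K.faces \ L.faces).Finite).toFinset
    (fun σ ↦ (Subtype.val ⁻¹' {y | y ∈ K.space ∧ ∀ t ∈ K.faces, y ∈ convexHull ℝ (↑t : Set E) → σ ⊆ t} : Set K.space)) (fun σ _ ↦ isOpen_preimage_faceStar hK σ)
  have hfin := hU (fun s' hs' hne k ↦ by exact hstep s' hs' hne k) k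
  have heq : (⋃ σ ∈ (hK.sdiff : (K.faces \ L.faces).Finite).toFinset,
      (Subtype.val ⁻¹' {y | y ∈ K.space ∧ ∀ t ∈ K.faces, y ∈ convexHull ℝ (↑t : Set E) → σ ⊆ t} : Set K.space)) = Subtype.val ⁻¹' (K.space \ L.space) := by
    rw [space_diff_space_eq_biUnion_faceStar hK hLK, Set.preimage_iUnion₂]
  have h3 : Module.Finite R (singularHomology R M
      ↥(Subtype.val ⁻¹' (K.space \ L.space) : Set K.space) k) :=
    finite_singularHomology_of_homeomorph (Homeomorph.setCongr heq) k
  exact finite_singularHomology_of_homeomorph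
    (SphereComplement.preimageValHomeomorphOfSubset (X := E) (S := K.space) sdiff_subset) k

end Complement


/-! ### Triangulation of the pair `(X(ℂ), Z(ℂ))` -/

variable {X : SchemeOver ℂ}

/-- **The complex points of a Zariski open of a projective variety are the complement of a
subcomplex in a finite polyhedron.** For `X` separated of finite type over `ℂ` with `X(ℂ)` compact
and `Z ⊆ X` Zariski-closed there are a finite geometric simplicial complex `K` in some `ℝⁿ` and a
subcomplex `L` with `(X ∖ Z)(ℂ) ≃ₜ |K| ∖ |L|`: a compact semialgebraic model `(S, A)` of
`(X(ℂ), Z(ℂ))` (`SemialgModel.exists_semialgebraic_model`), a semialgebraic triangulation of `S`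
compatible with `A` (`semialgebraic_triangulation`, Łojasiewicz / Ohmoto–Shiota Thm. 2.2, PROVED in
the tree) and the subcomplex over the closed set `A` (`exists_subcomplex_preimage`).
[cite: BochnakCosteRoy1998, Thm. 9.2.1] [cite: Dimca1992, Ch. 1 (6.9)–(6.10)] -/
theorem exists_homeomorph_space_diff_space [LocallyOfFiniteType X.hom] [IsSeparated X.hom]
    [CompactSpace (ComplexPoints X)] {Z : Set X.left} (hZ : IsClosed Z) :
    ∃ (n : ℕ) (K L : Geometry.SimplicialComplex ℝ (Fin n → ℝ)), K.faces.Finite ∧ L.faces ⊆ K.faces ∧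
      Nonempty (complexPointsCompl X Z ≃ₜ ↥(K.space \ L.space)) := by
  classical
  haveI : T2Space (ComplexPoints X) := ComplexPoints.t2Space_of_isSeparated X
  -- the semialgebraic model of the pair
  obtain ⟨T, N, Ψ, hTc, hT, hΨ, hinj, hS, hA⟩ :=
    SemialgModel.exists_semialgebraic_model (X := X) hZ isCompact_univ
  have hTu : T = univ := eq_univ_of_univ_subset (hT.trans interior_subset)
  set S : Set (Fin N → ℝ) := Ψ '' T with hSdef
  set A : Set (Fin N → ℝ) := Ψ '' (T ∩ {Q | Q.pt ∈ Z}) with hAdef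
  have hAS : A ⊆ S := image_mono inter_subset_left
  have hSc : IsCompact S := hTc.image hΨ
  have hZc : IsClosed {Q : ComplexPoints X | Q.pt ∈ Z} :=
    ⟨AlgPoints.isOpen_setOf_pt_mem (X := X) (L := ℂ) ⟨Zᶜ, hZ.isOpen_compl⟩⟩
  have hAc : IsClosed A := ((hTc.inter_right hZc).image hΨ).isClosed
  have hΨinj : Function.Injective Ψ := by rwa [hTu, injOn_univ] at hinj
  -- triangulate `S` compatibly with `A`
  obtain ⟨K, Φ, Ψ', hK, hhom, hcompat⟩ := semialgebraic_triangulation N S hS hSc {A}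
    (fun A' hA' ↦ by rw [Finset.mem_singleton] at hA'; subst hA'; exact ⟨hAS, hA⟩)
  have hdich : ∀ σ ∈ K.faces, Ψ' '' openSimplex ℝ σ ⊆ A ∨ Disjoint (Ψ' '' openSimplex ℝ σ) A := by
    intro σ hσ
    by_cases h : (Ψ' '' openSimplex ℝ σ ∩ A).Nonempty
    · exact Or.inl (hcompat A (Finset.mem_singleton_self A) σ hσ h)
    · exact Or.inr (disjoint_iff_inter_eq_empty.mpr (not_nonempty_iff_eq_empty.mp h))
  obtain ⟨L, -, hLK, -, hLsp⟩ := exists_subcomplex_preimage hK hhom.continuousOn_symm hAc hdich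
  refine ⟨_, K, L, hK, hLK, ⟨?_⟩⟩
  -- `X(ℂ) ≃ₜ S ≃ₜ |K|`
  have hemb : IsClosedEmbedding Ψ := hΨ.isClosedEmbedding hΨinj
  have hrange : range Ψ = S := by rw [hSdef, hTu, image_univ]
  let θ : ComplexPoints X ≃ₜ ↥K.space :=
    (hemb.isEmbedding.toHomeomorph.trans (Homeomorph.setCongr hrange)).trans hhom.toHomeomorph
  have hθ : ∀ P, (θ P : Fin _ → ℝ) = Φ (Ψ P) := fun P ↦ rfl
  -- membership in `Z(ℂ)` is read off the model
  have hmemA : ∀ P : ComplexPoints X, Ψ P ∈ A ↔ P.pt ∈ Z := by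
    intro P
    constructor
    · rintro ⟨Q, ⟨-, hQ⟩, hQP⟩
      rw [← hΨinj hQP]; exact hQ
    · intro hP
      exact ⟨P, ⟨by rw [hTu]; exact mem_univ P, hP⟩, rfl⟩
  have hiff : ∀ P : ComplexPoints X, P.pt ∉ Z ↔ Ψ' (θ P : Fin _ → ℝ) ∉ A := by
    intro P
    rw [hθ, hhom.left_inv (show Ψ P ∈ S from hrange ▸ mem_range_self P), hmemA]
  let θ' : complexPointsCompl X Z ≃ₜ {y : ↥K.space // Ψ' (y : Fin _ → ℝ) ∉ A} := θ.subtype hiff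
  -- `{y ∈ |K| : Ψ' y ∉ A} = |K| ∖ |L|`
  have hLmem : ∀ p, p ∈ L.space ↔ p ∈ K.space ∧ Ψ' p ∈ A := fun p ↦ by rw [hLsp]; rfl
  let e : {y : ↥K.space // Ψ' (y : Fin _ → ℝ) ∉ A} ≃ₜ ↥(K.space \ L.space) :=
    { toFun := fun y ↦ ⟨y.1.1, y.1.2, fun hL ↦ y.2 ((hLmem _).mp hL).2⟩
      invFun := fun z ↦ ⟨⟨z.1, z.2.1⟩, fun hz ↦ z.2.2 ((hLmem _).mpr ⟨z.2.1, hz⟩)⟩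
      left_inv := fun _ ↦ rfl
      right_inv := fun _ ↦ rfl
      continuous_toFun := (continuous_subtype_val.comp continuous_subtype_val).subtype_mk _
      continuous_invFun := (continuous_subtype_val.subtype_mk _).subtype_mk _ }
  exact θ'.trans e

/-- **Dimca 1992, Ch. 1 Cor. (6.10), for the Zariski opens of a projective variety — all degrees,
any Noetherian coefficients.** For `X` separated of finite type over `ℂ` with `X(ℂ)` compact (e.g.
`X` proper) and `Z ⊆ X` Zariski-closed, `Hₖ((X ∖ Z)(ℂ); M)` is finitely generated for every `k`
and every finitely generated module `M` over a Noetherian ring `R`.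
[cite: Dimca1992, Ch. 1 Cor. (6.10)] [cite: HatcherAT2002, §2.2 p. 149] -/
theorem finite_singularHomology_complexPointsCompl (R : Type) [CommRing R] [IsNoetherianRing R]
    (M : Type) [AddCommGroup M] [Module R M] [Module.Finite R M]
    [LocallyOfFiniteType X.hom] [IsSeparated X.hom] [CompactSpace (ComplexPoints X)]
    {Z : Set X.left} (hZ : IsClosed Z) (k : ℕ) :
    Module.Finite R (singularHomology R M (complexPointsCompl X Z) k) := by
  classical
  obtain ⟨n, K, L, hK, hLK, ⟨e⟩⟩ := exists_homeomorph_space_diff_space (X := X) hZ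
  haveI := finite_singularHomology_space_diff_space R M hK hLK k
  exact finite_singularHomology_of_homeomorph e.symm k

end ZariskiOpenFiniteness

/-- **Dimca 1992, Ch. 1 Cor. (6.10) — discharged.** The named fact
`Dimca1992_finite_singularHomology_complexPointsCompl` (`HodgeTheory/ZariskiOpenBettiFiniteness`):
for `X` smooth projective over `ℂ` and `Z ⊆ X` Zariski-closed, `Hₖ((X ∖ Z)(ℂ); ℤ)` is finitely
generated in every degree `k`. Proof: semialgebraic model and triangulation of the pair
`(X(ℂ), Z(ℂ))`, complement of a subcomplex = finite union of open stars, Mayer–Vietoris.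
[cite: Dimca1992, Ch. 1 Cor. (6.10)] -/
theorem Dimca1992_finite_singularHomology_complexPointsCompl_holds :
    Dimca1992_finite_singularHomology_complexPointsCompl := by
  intro n X hX Z hZ k
  haveI : IsProper X.hom := IsSmoothProjective.isProper_holds hX
  haveI := ComplexPoints.compactSpace_of_isSmoothProjective hX
  exact ZariskiOpenFiniteness.finite_singularHomology_complexPointsCompl ℤ ℤ hZ k

/-! ### Cohomology (appended): universal coefficients over a principal ideal domain -/

/-- **Finitely generated cohomology of the Zariski opens of a projective variety.** For `X` separated
of finite type over `ℂ` with `X(ℂ)` compact, `Z ⊆ X` Zariski-closed, `R` a principal ideal domain and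
`N` a finitely generated `R`-module, `Hᵏ((X ∖ Z)(ℂ); N)` is a finitely generated `R`-module for every
`k`: homology is finitely generated (`ZariskiOpenFiniteness.finite_singularHomology_complexPointsCompl`)
and cohomology follows by universal coefficients (Hatcher Cor. 3.3, the tree's
`finite_singularCohomology_of_finite_singularHomology`). [cite: Dimca1992, Ch. 1 Cor. (6.10)]
[cite: HatcherAT2002, §3.1 Cor. 3.3] -/
theorem ZariskiOpenFiniteness.finite_singularCohomology_complexPointsCompl (R : Type) [CommRing R]
    [IsDomain R] [IsPrincipalIdealRing R] (N : Type) [AddCommGroup N] [Module R N]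
    [Module.Finite R N] {X : SchemeOver ℂ} [LocallyOfFiniteType X.hom] [IsSeparated X.hom]
    [CompactSpace (ComplexPoints X)] {Z : Set X.left} (hZ : IsClosed Z) (k : ℕ) :
    Module.Finite R (singularCohomology R N (complexPointsCompl X Z) k) :=
  haveI : ∀ m, Module.Finite R (singularHomology R R (complexPointsCompl X Z) m) := fun m ↦
    ZariskiOpenFiniteness.finite_singularHomology_complexPointsCompl R R hZ m
  finite_singularCohomology_of_finite_singularHomology k fun _ _ ↦ inferInstance

/-- **Dimca 1992, Ch. 1 Cor. (6.10), cohomological half, for the Zariski opens of a smooth projective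
complex variety**: `Hᵏ((X ∖ Z)(ℂ); ℤ)` is a finitely generated abelian group for `X` smooth projective
over `ℂ`, `Z ⊆ X` Zariski-closed and every `k` (printed: "the homology and cohomology groups
`Hᵢ(X; A)`, `Hⁱ(X; A)` … are all finitely generated"). [cite: Dimca1992, Ch. 1 Cor. (6.10)] -/
theorem Dimca1992_finite_singularCohomology_complexPointsCompl :
    ∀ ⦃n : ℕ⦄ ⦃X : SchemeOver ℂ⦄, IsSmoothProjective n X →
      ∀ (Z : Set X.left), IsClosed Z → ∀ k : ℕ,
        Module.Finite ℤ (singularCohomology ℤ ℤ (complexPointsCompl X Z) k) := by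
  intro n X hX Z hZ k
  haveI : IsProper X.hom := IsSmoothProjective.isProper_holds hX
  haveI := ComplexPoints.compactSpace_of_isSmoothProjective hX
  exact ZariskiOpenFiniteness.finite_singularCohomology_complexPointsCompl ℤ ℤ hZ k

end Literature.AlgebraicGeometry.HodgeTheory

end
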